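import Summits.NavierStokesRegularity.NavierStokesRegularity.Theorems.FilamentSkeletonRssExchangeBarrier

/-!
# Route `FilamentSkeletonRss` — exchange-certificate API, III: flow lines, monotonicity, and
# stability of the action under perturbation of the drift

Three more tools for `CertifiedSelectionBox` / `SignedTransverseReduction`:

* `fwAction_eq_zero_of_flow`, `qPot_eq_zero_of_flow`: a `C¹` FLOW LINE of `W` (`φ′ = W(φ)`) inside
  `S` has zero action, so the quasipotential along it vanishes (zero-cost capture / zero-cost entry of
  donors — the `captured` set and the cheap imports of the certificate);
* `qPot_mono_set`: enlarging the admissible region can only lower the quasipotential;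
* `fwAction_le_of_near` (UPPER stability): if `‖W′ − W‖ ≤ ε` along the path then
  `A_{W′}(φ) ≤ (1+δ) A_W(φ) + (1+δ⁻¹) ε² T/4` for every `δ > 0` — the form in which an action computed
  for the `Γ → ∞` limit field bounds the action for the rescaled field at finite `Γ`;
* `subsolution_of_near` (LOWER stability): an HJ sub-solution with slack,
  `⟪∇ψ, W⟫ + ‖∇ψ‖² ≤ −s` and `‖∇ψ‖ ≤ G` on `S`, stays a sub-solution for every `W′` with
  `‖W′ − W‖ ≤ s/G` on `S` — so one certified barrier serves all large `Γ`.

## References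
* M. I. Freidlin, A. D. Wentzell, *Random Perturbations of Dynamical Systems*, 3rd ed. (2012),
  Ch. 4 §1. [FreidlinWentzell2012]
-/

set_option linter.dupNamespace false -- the module path `Summits.NavierStokesRegularity.NavierStokesRegularity.…` repeats a component by layout (D-0017)

noncomputable section

namespace Summit.NavierStokesRegularity.NavierStokesRegularity.Theorems.FilamentExchange

open scoped Topology ENNReal InnerProductSpace RealInnerProductSpace
open Set Function MeasureTheory

/-- A flow line has zero action on `[0,T]`. [folklore] -/
theorem fwAction_eq_zero_of_flow {W : EuclideanSpace ℝ (Fin 3) → EuclideanSpace ℝ (Fin 3)} {T : ℝ}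
    {φ : ℝ → EuclideanSpace ℝ (Fin 3)} (hflow : ∀ t ∈ uIcc 0 T, deriv φ t = W (φ t)) :
    fwAction W T φ = 0 := by
  unfold fwAction
  rw [intervalIntegral.integral_congr (g := fun _ => (0:ℝ)) fun t ht => by simp [hflow t ht]]
  simp

/-- **Zero-cost connection along a flow line**: if a `C¹` flow line of `W` runs from `x` to `y` inside
`S` then `V_S(x → y) = 0`. [cite: FreidlinWentzell2012, Ch. 4 §1] -/
theorem qPot_eq_zero_of_flow {W : EuclideanSpace ℝ (Fin 3) → EuclideanSpace ℝ (Fin 3)}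
    {S : Set (EuclideanSpace ℝ (Fin 3))} {x y : EuclideanSpace ℝ (Fin 3)} {T : ℝ}
    {φ : ℝ → EuclideanSpace ℝ (Fin 3)} (hT : 0 ≤ T) (hφ : ContDiff ℝ 1 φ) (h0 : φ 0 = x) (h1 : φ T = y)
    (hS : ∀ t ∈ Icc 0 T, φ t ∈ S) (hflow : ∀ t ∈ Icc 0 T, deriv φ t = W (φ t)) :
    qPot W S x y = 0 := by
  refine le_antisymm ?_ bot_le
  have h := qPot_le_of_path (W := W) hT hφ h0 h1 hS
  rwa [fwAction_eq_zero_of_flow (fun t ht => hflow t (by rwa [uIcc_of_le hT] at ht)),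
    ENNReal.ofReal_zero] at h

/-- **Monotonicity in the region**: more room, cheaper connection. [folklore] -/
theorem qPot_mono_set {W : EuclideanSpace ℝ (Fin 3) → EuclideanSpace ℝ (Fin 3)}
    {S S' : Set (EuclideanSpace ℝ (Fin 3))} (hSS' : S ⊆ S') (x y : EuclideanSpace ℝ (Fin 3)) :
    qPot W S' x y ≤ qPot W S x y :=
  sInf_le_sInf fun _ ⟨T, φ, hT, hφ, h0, h1, hS, hr⟩ => ⟨T, φ, hT, hφ, h0, h1, fun t ht => hSS' (hS t ht), hr⟩

/-- Peter–Paul for the integrand: `‖a − w′‖² ≤ (1+δ)‖a − w‖² + (1+δ⁻¹)‖w′ − w‖²`. [folklore] -/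
theorem norm_sub_sq_le_peterPaul {a w w' : EuclideanSpace ℝ (Fin 3)} {δ : ℝ} (hδ : 0 < δ) :
    ‖a - w'‖ ^ 2 ≤ (1 + δ) * ‖a - w‖ ^ 2 + (1 + δ⁻¹) * ‖w' - w‖ ^ 2 := by
  have hsplit : a - w' = (a - w) - (w' - w) := by abel
  have htri : ‖a - w'‖ ≤ ‖a - w‖ + ‖w' - w‖ := by rw [hsplit]; exact norm_sub_le _ _
  have hx := norm_nonneg (a - w)
  have hy := norm_nonneg (w' - w)
  have h1 : ‖a - w'‖ ^ 2 ≤ (‖a - w‖ + ‖w' - w‖) ^ 2 := by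
    exact pow_le_pow_left₀ (norm_nonneg _) htri 2
  -- 2xy ≤ δ x² + δ⁻¹ y²
  have h2 : 2 * ‖a - w‖ * ‖w' - w‖ ≤ δ * ‖a - w‖ ^ 2 + δ⁻¹ * ‖w' - w‖ ^ 2 := by
    have h3 : 0 ≤ (Real.sqrt δ * ‖a - w‖ - (Real.sqrt δ)⁻¹ * ‖w' - w‖) ^ 2 := sq_nonneg _
    have hsd : Real.sqrt δ ^ 2 = δ := Real.sq_sqrt hδ.le
    have hsd' : (Real.sqrt δ)⁻¹ ^ 2 = δ⁻¹ := by rw [inv_pow, hsd]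
    have hss : Real.sqrt δ * (Real.sqrt δ)⁻¹ = 1 := mul_inv_cancel₀ (Real.sqrt_pos.2 hδ).ne'
    nlinarith [h3, hsd, hsd', hss]
  nlinarith [h1, h2]

/-- **Upper stability of the action**: if `‖W′(φ t) − W(φ t)‖ ≤ ε` on `[0,T]` (e.g. `W′` = the rescaled
frame field at finite `Γ`, `W` = its `Γ → ∞` limit) then, for every `δ > 0`,
`A_{W′}(φ) ≤ (1+δ)·A_W(φ) + (1+δ⁻¹)·ε²·T/4`. [folklore] -/
theorem fwAction_le_of_near {W W' : EuclideanSpace ℝ (Fin 3) → EuclideanSpace ℝ (Fin 3)}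
    (hW : Continuous W) (hW' : Continuous W') {T : ℝ} (hT : 0 ≤ T) {φ : ℝ → EuclideanSpace ℝ (Fin 3)}
    (hφ : ContDiff ℝ 1 φ) {ε δ : ℝ} (hδ : 0 < δ) (hnear : ∀ t ∈ Icc 0 T, ‖W' (φ t) - W (φ t)‖ ≤ ε) :
    fwAction W' T φ ≤ (1 + δ) * fwAction W T φ + (1 + δ⁻¹) * ε ^ 2 * T / 4 := by
  have hφ'c : Continuous (deriv φ) := hφ.continuous_deriv le_rfl
  have hg : Continuous fun t => ‖deriv φ t - W (φ t)‖ ^ 2 / 4 :=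
    ((hφ'c.sub (hW.comp hφ.continuous)).norm.pow 2).div_const _
  have hc1 : Continuous fun t => ‖deriv φ t - W' (φ t)‖ ^ 2 / 4 :=
    ((hφ'c.sub (hW'.comp hφ.continuous)).norm.pow 2).div_const _
  have hi2 : IntervalIntegrable (fun t => (1 + δ) * (‖deriv φ t - W (φ t)‖ ^ 2 / 4)) volume 0 T :=
    (continuous_const.mul hg).intervalIntegrable _ _
  have hi3 : IntervalIntegrable (fun _ : ℝ => (1 + δ⁻¹) * ε ^ 2 / 4) volume 0 T :=
    continuous_const.intervalIntegrable _ _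
  unfold fwAction
  calc ∫ t in (0:ℝ)..T, ‖deriv φ t - W' (φ t)‖ ^ 2 / 4
      ≤ ∫ t in (0:ℝ)..T, ((1 + δ) * (‖deriv φ t - W (φ t)‖ ^ 2 / 4) + (1 + δ⁻¹) * ε ^ 2 / 4) := by
        refine intervalIntegral.integral_mono_on hT (hc1.intervalIntegrable _ _) (hi2.add hi3)
          fun t ht => ?_
        have hpp := norm_sub_sq_le_peterPaul (a := deriv φ t) (w := W (φ t)) (w' := W' (φ t)) hδ
        have hε : ‖W' (φ t) - W (φ t)‖ ^ 2 ≤ ε ^ 2 := by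
          have h0 : 0 ≤ ‖W' (φ t) - W (φ t)‖ := norm_nonneg _
          exact pow_le_pow_left₀ h0 (hnear t ht) 2
        have hδ' : 0 ≤ 1 + δ⁻¹ := by positivity
        nlinarith [hpp, hε, hδ']
    _ = (1 + δ) * (∫ t in (0:ℝ)..T, ‖deriv φ t - W (φ t)‖ ^ 2 / 4) + (1 + δ⁻¹) * ε ^ 2 * T / 4 := by
        rw [intervalIntegral.integral_add hi2 hi3, intervalIntegral.integral_const_mul,
          intervalIntegral.integral_const]
        simp only [sub_zero, smul_eq_mul]
        ring

/-- **Lower stability (barriers survive perturbation)**: an HJ sub-solution for `W` with slack `s` and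
gradient bound `G` on `S` (`⟪∇ψ, W⟫ + ‖∇ψ‖² ≤ −s`, `‖∇ψ‖ ≤ G`) is an HJ sub-solution for every `W′`
with `‖W′ − W‖ ≤ s/G` on `S`; hence `le_qPot_of_subsolution` applies to `W′` with the same `ψ`.
[folklore] -/
theorem subsolution_of_near {W W' : EuclideanSpace ℝ (Fin 3) → EuclideanSpace ℝ (Fin 3)}
    {S : Set (EuclideanSpace ℝ (Fin 3))} {ψ : EuclideanSpace ℝ (Fin 3) → ℝ} {s G : ℝ} (hG : 0 < G)
    (hHJ : ∀ z ∈ S, ⟪gradient ψ z, W z⟫ + ‖gradient ψ z‖ ^ 2 ≤ -s)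
    (hgrad : ∀ z ∈ S, ‖gradient ψ z‖ ≤ G) (hnear : ∀ z ∈ S, ‖W' z - W z‖ ≤ s / G) :
    ∀ z ∈ S, ⟪gradient ψ z, W' z⟫ + ‖gradient ψ z‖ ^ 2 ≤ 0 := by
  intro z hz
  have hsplit : ⟪gradient ψ z, W' z⟫ = ⟪gradient ψ z, W z⟫ + ⟪gradient ψ z, W' z - W z⟫ := by
    rw [← inner_add_right, add_sub_cancel]
  have hcs : ⟪gradient ψ z, W' z - W z⟫ ≤ ‖gradient ψ z‖ * ‖W' z - W z‖ := real_inner_le_norm _ _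
  have hb : ‖gradient ψ z‖ * ‖W' z - W z‖ ≤ G * (s / G) :=
    mul_le_mul (hgrad z hz) (hnear z hz) (norm_nonneg _) hG.le
  rw [mul_div_cancel₀ _ hG.ne'] at hb
  linarith [hHJ z hz, hsplit, hcs, hb]

end Summit.NavierStokesRegularity.NavierStokesRegularity.Theorems.FilamentExchange

end
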